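import Literature.AnabelianGeometry.AbsoluteAnabelian.LocalUnramifiedQuotientH2Index
import Literature.AnabelianGeometry.AbsoluteAnabelian.FreeProcyclicStructure
import Literature.NumberTheory.GaloisRepresentations.LocalInertiaComapRestrict
import HarnessLib

/-!
# `Gal(E^nr/E) ↪ Gal(F^nr/F)` is injective with open image of index `f` (the residue degree)

abc-iut cell, layer L4.  PROOF file (no definition, no named fact).  For an algebraic extension
`E/F` of non-archimedean local fields with `q_E = q_F ^ f`, the map of unramified quotients
`unrQuotientMap F E : Gal(E^nr/E) = Γ_E ⧸ Gal(Ē/E^nr) → Gal(F^nr/F) = Γ_F ⧸ Gal(F̄/F^nr)` induced by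
restriction (`LocalUnramifiedQuotientH2Index.lean`, `Frob̄_E ↦ Frob̄_F ^ f`) is

* `galUnr_eq_comap_absGaloisRestrict` — `Gal(Ē/E^nr) = res⁻¹(Gal(F̄/F^nr))` (trunk
  `absInertia_eq_comap_absGaloisRestrict`, `galUnr_eq_absInertia`);
* **`unrQuotientMap_injective`**;
* **`range_unrQuotientMap_eq`** — its image is `closure ⟨Frob̄_F ^ f⟩`, and
  **`isOpen_range_unrQuotientMap`, `index_range_unrQuotientMap : (range).index = f`** — the open
  subgroup of index `f` of the free procyclic group `Gal(F^nr/F)` (`FreeProcyclicStructure`: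
  the open subgroup of index `n` of a compact group with dense `⟨γ⟩` is `closure ⟨γⁿ⟩`);
* `isClosedEmbedding_unrQuotientMap` (a continuous injection of a compact group into a Hausdorff
  group is a closed embedding, i.e. a topological isomorphism onto its image).

This is "`E^nr = E·F^nr` and `Gal(E^nr/E) ≅ Gal(F^nr/(E ∩ F^nr))`, of index `f = [E ∩ F^nr : F]` in
`Gal(F^nr/F)`" (Serre, *Local Fields* III §5; I §7 Prop. 22, I §8), i.e. the «index of the image of
the induced open homomorphism» of [AbsTopIII] Rmk. 3.2.2 / Rmk. 1.10.1 (iii) computed on the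
unramified quotients (it is `f`, while on the full groups `Γ_E ↪ Γ_F` it is `[E : F] = e f`) — the
factor in the index formula `inv_E ∘ res = f • inv_F` of `H2UnrEquivQModZ_pullH_unrQuotientMap`.

HONEST FRAMING: classical; nothing here bears on [IUTchIII] Cor. 3.12 or takes a side.
-/

noncomputable section

open CategoryTheory Function
open Field IsNonarchimedeanLocalField ValuativeRel

universe u

namespace Literature.AnabelianGeometry.AbsoluteAnabelian

open Literature.NumberTheory.GaloisRepresentations
open Literature.NumberTheory.GaloisRepresentations.IsNonarchimedeanLocalField
open _root_.Topology

variable (F E : Type u) [Field F] [ValuativeRel F] [TopologicalSpace F] [IsNonarchimedeanLocalField F]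
  [Field E] [ValuativeRel E] [TopologicalSpace E] [IsNonarchimedeanLocalField E] [Algebra F E]
  [Algebra.IsAlgebraic F E]

/-- **`Gal(Ē/E^nr) = res⁻¹(Gal(F̄/F^nr))`** (`E/F` algebraic): both sides are inertia groups
(`galUnr_eq_absInertia`) and `I_E = res⁻¹(I_F)`. [cite: SerreLocalFields1979, Ch. I §7 Prop. 22 a)] -/
theorem galUnr_eq_comap_absGaloisRestrict :
    galUnr E = (galUnr F).comap (absGaloisRestrict F E).toMonoidHom := by
  rw [galUnr_eq_absInertia, galUnr_eq_absInertia, absInertia_eq_comap_absGaloisRestrict F E]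

/-- **`Gal(E^nr/E) → Gal(F^nr/F)` is injective** (`E/F` algebraic).
[cite: SerreLocalFields1979, Ch. III §5] -/
theorem unrQuotientMap_injective : Injective (unrQuotientMap F E) := by
  refine (injective_iff_map_eq_one _).2 fun q hq => ?_
  obtain ⟨σ, rfl⟩ := QuotientGroup.mk_surjective q
  rw [unrQuotientMap_mk, QuotientGroup.eq_one_iff] at hq
  rw [QuotientGroup.eq_one_iff, galUnr_eq_comap_absGaloisRestrict F E, Subgroup.mem_comap]
  exact hq

omit [Algebra.IsAlgebraic F E] in
/-- The image of `Gal(E^nr/E) → Gal(F^nr/F)` is closed (continuous image of a compact group in a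
Hausdorff group). [cite: SerreLocalFields1979, Ch. III §5] -/
theorem isClosed_range_unrQuotientMap :
    IsClosed ((unrQuotientMap F E).toMonoidHom.range : Set (absoluteGaloisGroup F ⧸ galUnr F)) := by
  rw [MonoidHom.coe_range]
  exact (isCompact_range (unrQuotientMap F E).continuous).isClosed

variable {F E} in
omit [Algebra.IsAlgebraic F E] in
/-- **The image of `Gal(E^nr/E)` in `Gal(F^nr/F)` is `closure ⟨Frob̄_F ^ f⟩`**, `f` the residue degree
(`q_E = q_F ^ f`): it is closed, contains `Frob̄_F ^ f = image of Frob̄_E`, and `Gal(E^nr/E)` is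
topologically generated by `Frob̄_E`. [cite: SerreLocalFields1979, Ch. III §5] -/
theorem range_unrQuotientMap_eq {φF : absoluteGaloisGroup F} (hφF : IsFrobPow φF 1) {f : ℕ}
    (hf : residueFieldCard E = residueFieldCard F ^ f) :
    (unrQuotientMap F E).toMonoidHom.range =
      (Subgroup.zpowers ((QuotientGroup.mk φF : absoluteGaloisGroup F ⧸ galUnr F) ^ f)).topologicalClosure := by
  obtain ⟨φE, hφE⟩ := exists_isFrobPow_holds (F := E) 1
  have himg : unrQuotientMap F E (QuotientGroup.mk φE) = (QuotientGroup.mk φF) ^ f :=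
    unrQuotientMap_mk_eq_pow hφE hφF hf
  refine le_antisymm ?_ ?_
  · -- the preimage of the closed subgroup `closure ⟨Frob̄_F ^ f⟩` is a closed subgroup containing the
    -- dense subgroup `⟨Frob̄_E⟩`, hence everything
    set K := (Subgroup.zpowers ((QuotientGroup.mk φF : absoluteGaloisGroup F ⧸ galUnr F) ^ f)).topologicalClosure
      with hK
    have hle : Subgroup.zpowers (QuotientGroup.mk φE : absoluteGaloisGroup E ⧸ galUnr E) ≤
        K.comap (unrQuotientMap F E).toMonoidHom := by
      rw [Subgroup.zpowers_le, Subgroup.mem_comap]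
      change unrQuotientMap F E (QuotientGroup.mk φE) ∈ K
      rw [himg]
      exact Subgroup.le_topologicalClosure _ (Subgroup.mem_zpowers _)
    have hclosed : IsClosed ((K.comap (unrQuotientMap F E).toMonoidHom :
        Subgroup (absoluteGaloisGroup E ⧸ galUnr E)) : Set (absoluteGaloisGroup E ⧸ galUnr E)) :=
      (Subgroup.isClosed_topologicalClosure _).preimage (unrQuotientMap F E).continuous
    rintro x ⟨q, rfl⟩
    have hq : q ∈ closure ((Subgroup.zpowers (QuotientGroup.mk φE : absoluteGaloisGroup E ⧸ galUnr E)) :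
        Set (absoluteGaloisGroup E ⧸ galUnr E)) := by
      rw [(dense_zpowers_mk_of_isFrobPow hφE).closure_eq]; exact Set.mem_univ q
    exact (Subgroup.mem_comap.mp (closure_minimal (fun z hz => hle hz) hclosed hq) : _)
  · -- `closure ⟨Frob̄_F ^ f⟩ ≤ range`, the range being a closed subgroup containing `Frob̄_F ^ f`
    refine Subgroup.topologicalClosure_minimal _ ?_ (isClosed_range_unrQuotientMap F E)
    rw [Subgroup.zpowers_le, ← himg]
    exact ⟨QuotientGroup.mk φE, rfl⟩

variable {F E} in
omit [Algebra.IsAlgebraic F E] in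
/-- **The image of `Gal(E^nr/E)` in `Gal(F^nr/F)` is the open subgroup of index `f`** (`f ≥ 1` the
residue degree): `Gal(F^nr/F) ≅ Ẑ` has an open subgroup of index `f`, which is `closure ⟨Frob̄_F ^ f⟩`.
[cite: SerreLocalFields1979, Ch. III §5] -/
theorem isOpen_range_unrQuotientMap {f : ℕ} (hf0 : 0 < f)
    (hf : residueFieldCard E = residueFieldCard F ^ f) :
    IsOpen ((unrQuotientMap F E).toMonoidHom.range : Set (absoluteGaloisGroup F ⧸ galUnr F)) ∧
      (unrQuotientMap F E).toMonoidHom.range.index = f := by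
  obtain ⟨φF, hφF⟩ := exists_isFrobPow_holds (F := F) 1
  obtain ⟨H, hHo, hHi⟩ := exists_isOpen_index_quotient_galUnr F f hf0
  have hH : H = (unrQuotientMap F E).toMonoidHom.range := by
    rw [range_unrQuotientMap_eq hφF hf]
    exact eq_closureZpowersPow_of_isOpen_of_index (dense_zpowers_mk_of_isFrobPow hφF) hHo hf0 hHi
  subst hH
  exact ⟨hHo, hHi⟩

variable {F E} in
omit [Algebra.IsAlgebraic F E] in
/-- `(image of Gal(E^nr/E) in Gal(F^nr/F)).index = f`. [cite: SerreLocalFields1979, Ch. III §5] -/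
theorem index_range_unrQuotientMap {f : ℕ} (hf0 : 0 < f)
    (hf : residueFieldCard E = residueFieldCard F ^ f) :
    (unrQuotientMap F E).toMonoidHom.range.index = f :=
  (isOpen_range_unrQuotientMap hf0 hf).2

/-- **`Gal(E^nr/E) → Gal(F^nr/F)` is a closed embedding** (an injective continuous homomorphism of a
compact group into a Hausdorff group), i.e. a topological isomorphism onto its open image of index `f`.
[cite: SerreLocalFields1979, Ch. III §5] -/
theorem isClosedEmbedding_unrQuotientMap : IsClosedEmbedding (unrQuotientMap F E) :=
  (unrQuotientMap F E).continuous.isClosedEmbedding (unrQuotientMap_injective F E)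

end Literature.AnabelianGeometry.AbsoluteAnabelian

end
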